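import Literature.NumberTheory.LFunctions.SiegelZeroFormSumAsymptotic
import Mathlib.Analysis.SpecialFunctions.Log.Monotone
import Mathlib.Analysis.Complex.ExponentialBounds
import Mathlib.NumberTheory.Real.Irrational
import HarnessLib

/-!
# Goldfeld–Schinzel 1975, Theorem 2 for `d > 676` — PROVED:
# `Σ_{(a,b,c) ∈ C, −|a| < b ≤ |a| ≤ ¼√d} 1/|a| ≤ log ε₀/log(½√d − 1) + 4/√d`

Topic `Literature/NumberTheory/LFunctions` (namespace `Literature.NumberTheory.LFunctions`, auxiliary
lemmas in `GoldfeldSchinzel1975` as in the statement file). PROOF LAYER (theorems only: no definitions,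
no named facts, debt −1) for `SiegelZeroFormSumAsymptotic.lean`: the discharge
`goldfeldSchinzel1975_theorem2_pos_holds : goldfeldSchinzel1975_theorem2_pos` of Goldfeld–Schinzel's
Theorem 2 in the real quadratic case [GoldfeldSchinzel1975, Theorem 2 pp. 571–572, proof §3
pp. 577–582], exactly as typed there (cell `parity-realchar`, conditionals column I.17; typed and proved
by the cross-ladder literature-typing seat `littype-FP2-1`).

## The printed statement and proof (source read first-hand, Numdam scan pp. 571–583)

p. 571–572: "THEOREM 2. If `(a, b, c)` runs through a class `C` of properly equivalent primitive forms
of discriminant `d`, supposed fundamental, then `Σ_{(a,b,c) ∈ C, ¼√|d| ≥ |a| ≥ b > −|a|} 1/|a| ≤ 1/m₀`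
if `d < 0`, `≤ log ε₀/log(½√d − 1) + 4/√d` if `d > 676`, where `m₀` is the least positive integer
represented by `C` and `ε₀` is the least totally positive unit of the field `Q(√d)`." The printed proof
for `d > 0` (§3): choose `(α, β, γ) ∈ C` reduced in the sense of Gauss, `α > 0`; for a window form
`f = (α, β, γ)T`, `T = (p r; q s)` with `p, q > 0` (Jones, Thm 79), (12) `αp² + βpq + γq² = a` gives
`|p/q − ω| < ½q⁻²` for `ω = (−β + √d)/(2α)`, so `p/q` is a convergent of `ω = [0, b₁, …, b_k]`
(purely periodic after `0`), (14)–(15) (Perron §20) give `f = ((−1)^v Q_v/2, (−1)^{v−1}P_v,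
(−1)^v Q_{v−1}/2)(1 t; 0 (−1)^v)`, whence (16) `Σ″ 1/|a| ≤ Σ_{v ≤ [k,2], Q_v < ½√d} 2/Q_v`, then
`√d > b_v ≥ 2`, `b_v + 1 > √d/Q_v` (Lemma 3), (17) `ε₀ > b_l B_{l−1} > ∏ b_v` (Lang, Ch. IV Thm 7), and
(18) `Σ″ 1/|a| ≤ (2/√d) max Σ(x_i + 1)` over `2 ≤ x_i ≤ ½√d − 1`, `∏ x_i < ε₀`, maximised in three
cases using `d > 676` (pp. 581–582).

## The road taken here (a deviation, documented)

The tree's continued-fraction infrastructure (`QuadraticFields/ReducedQuadraticIrrationals*.lean`,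
`RealQuadraticFundamentalUnit.lean`) identifies `∏ ψ_k` with the fundamental unit for the PRINCIPAL
cycle only and has no class-to-cycle theorem for indefinite forms, so the printed road would need two
new infrastructure files. Instead we prove the same printed bound by a self-contained norm-form /
unit-orbit argument (which in fact gives `Σ 1/|a| ≤ log ε₀/log(½√d − 1)` without the `4/√d`, and uses
neither the minimality of `(t₀, u₀)` nor the primitivity of `f₀` nor the character):

* `eval_eq_mul_factors`: for `f = f₀·γ`, `γ = (p q; r s) ∈ SL₂(ℤ)`, `a_f = f₀(p, r) = α λ λ'` with
  `λ = p − ωr`, `λ' = p − ω'r`, `ω, ω' = (−β ± √d)/(2α)` (the printed (12));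
* `act_unit_eq`, `unit_mul_factor`, `unit_inv_mul_factor`, `unit_mul_inv`: the automorph
  `U = ((t₀ + βu₀)/2, γu₀; −αu₀, (t₀ − βu₀)/2) ∈ SL₂(ℤ)` of `f₀` multiplies `λ` by
  `ε₀ = (t₀ + u₀√d)/2` (and `U⁻¹` by `ε₀⁻¹`), so every window form `f ~ f₀` has a representative
  `λ_f ∈ [1, ε₀)`; distinct window forms have distinct representatives (equal `λ` forces proportional,
  hence equal, first columns, so the forms are translates `b' = b + 2at`, and `−|a| < b, b' ≤ |a|`
  gives `t = 0`; non-proportional columns with equal `λ` would make `√d` rational);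
* `cross_identity`, `separation`: for representatives `λ < μ` of window forms `f, g`,
  `λμ' − λ'μ = (√d/α)(p₁r₂ − p₂r₁)` with a NON-ZERO integer, so `√d ≤ |a_g|/x + |a_f|x`, `x = μ/λ`;
* `inv_le_log_div_log`: with `1 ≤ |a| ≤ ¼√d` this gives `x ≥ 2 + √3 > e`, `|a_f|x ≥ ¾√d` and
  **`1/|a_f| ≤ log x/log(½√d − 1)`** (for `x ≥ ½√d − 1` since `1/|a_f| ≤ 1`; for `e ≤ x < ½√d − 1`
  since `log t/t` is antitone on `[e, ∞)`, Mathlib `Real.log_div_self_antitoneOn`) — this one-line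
  per-term bound replaces the printed three-case maximisation;
* `chain_bound`: chaining the representatives in increasing order and closing up with `ε₀λ_min`, the
  ratios multiply to `ε₀`, so `Σ_{f ∈ S} 1/|a_f| · log(½√d − 1) ≤ log ε₀`.

`D` is not a square because `t₀² − Du₀² = 4` has a solution with `u₀ ≥ 1` and `D > 676`
(`(nu₀)² < t₀² = (nu₀)² + 4 < (nu₀ + 1)²`).

LABEL (cell rule): conditionals column I.17, kernel, hypothesis-free. WHAT THIS IS NOT: nothing on
Theorem 1, Lemma 1 or the Corollary (the `d > 0` half of the Corollary also needs the lower half of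
Theorem 1 for even characters and the real-quadratic class number formula summed over narrow classes);
nothing here bears on parity (H5). No definitions, no instances, no notation, no axioms.

## References

* [GoldfeldSchinzel1975] D. M. Goldfeld, A. Schinzel, *On Siegel's zero*, Ann. Scuola Norm. Sup. Pisa
  Cl. Sci. (4) **2** (1975) 571–583: Theorem 2 (pp. 571–572), §3 (pp. 577–582: (10)–(18), Lemma 3).
* [Cox2013] D. A. Cox, *Primes of the form x² + ny²*, 2nd ed., §2.A (forms, `SL₂(ℤ)`-action; the
  tree's `BinQF`).
-/

noncomputable section

open Finset
open scoped Classical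

namespace Literature.NumberTheory.LFunctions

open Literature.NumberTheory.QuadraticFields.Quadratic

namespace GoldfeldSchinzel1975

/-- **Per-term lemma** for Theorem 2 (`d > 0`): if `1 ≤ A ≤ s/4`, `0 ≤ B ≤ s/4`, `x > 1` and
`s ≤ B/x + A·x` (`s = √d > 26`), then `1/A ≤ log x / log(s/2 − 1)`. (From the constraint,
`x + 1/x ≥ 4`, so `x ≥ 2 + √3 > e`, and `A·x ≥ ¾ s`; for `x ≥ X = s/2 − 1` the bound is `1/A ≤ 1`,
for `e ≤ x < X` it is `1/A ≤ 4x/(3s) ≤ x/X ≤ log x/log X` by the monotonicity of `log t/t`.)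
This replaces the three-case optimisation of [GoldfeldSchinzel1975, §3 pp. 581–582].
[cite: GoldfeldSchinzel1975, Theorem 2 pp. 571–572, §3 (16)–(18) pp. 580–582] -/
theorem inv_le_log_div_log {s A B x : ℝ} (hs : 26 < s) (hA1 : 1 ≤ A) (hA : 4 * A ≤ s)
    (hB0 : 0 ≤ B) (hB : 4 * B ≤ s) (hx : 1 < x) (hkey : s ≤ B / x + A * x) :
    1 / A ≤ Real.log x / Real.log (s / 2 - 1) := by
  have hA0 : 0 < A := by linarith
  have hx0 : 0 < x := by linarith
  set X := s / 2 - 1 with hX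
  have hX1 : 1 < X := by rw [hX]; linarith
  have hX0 : 0 < X := by linarith
  have hlogX : 0 < Real.log X := Real.log_pos hX1
  -- `B/x ≤ B` and `B/x ≤ (s/4)/x`
  have hBx : B / x ≤ B := div_le_self hB0 hx.le
  have hBx' : B / x ≤ s / 4 * (1 / x) := by
    rw [mul_one_div]
    exact div_le_div_of_nonneg_right (by linarith) hx0.le
  -- `x + 1/x ≥ 4`
  have h1x : x * (1 / x) = 1 := by field_simp
  have h2 : 4 * x ≤ 1 + x ^ 2 := by
    -- from `s ≤ B/x + A x ≤ (s/4)(1/x) + (s/4) x`, multiply by `4x/s`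
    have hs0 : 0 < s := by linarith
    have h1 : s ≤ s / 4 * (1 / x) + s / 4 * x := by nlinarith
    have h1' : s * (4 * x) ≤ s * (1 + x ^ 2) := by
      have := mul_le_mul_of_nonneg_right h1 (by linarith : (0 : ℝ) ≤ 4 * x)
      have e : (s / 4 * (1 / x) + s / 4 * x) * (4 * x) = s * (1 + x ^ 2) := by
        field_simp
      linarith [e]
    exact le_of_mul_le_mul_left h1' hs0
  have h37 : 3.7 ≤ x := by nlinarith
  -- `A x ≥ 3s/4`
  have hAx : 3 * s / 4 ≤ A * x := by linarith
  by_cases hcase : X ≤ x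
  · have hlx : Real.log X ≤ Real.log x := Real.log_le_log hX0 hcase
    have h1 : 1 ≤ Real.log x / Real.log X := by rw [le_div_iff₀ hlogX]; linarith
    calc 1 / A ≤ 1 := by rw [div_le_one hA0]; exact hA1
      _ ≤ _ := h1
  · push Not at hcase
    have he : Real.exp 1 ≤ x := (lt_trans Real.exp_one_lt_d9 (by norm_num)).le.trans h37
    have heX : Real.exp 1 ≤ X := he.trans hcase.le
    have hanti : Real.log X / X ≤ Real.log x / x :=
      Real.log_div_self_antitoneOn he heX hcase.le
    rw [div_le_div_iff₀ hX0 hx0] at hanti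
    -- hanti : log X * x ≤ log x * X
    have h3 : 1 / A ≤ x / X := by
      rw [div_le_div_iff₀ hA0 hX0]
      nlinarith
    calc 1 / A ≤ x / X := h3
      _ ≤ Real.log x / Real.log X := by
          rw [div_le_div_iff₀ hX0 hlogX]
          linarith

/-- **Chain lemma** (abstract telescoping for Theorem 2, `d > 0`). Items `f ∈ S` carry weights `w f`
and representatives `ℓ f ∈ [1, E)` of a family `Good f` of admissible positive reals closed under
multiplication by `E`; if for admissible `λ < μ` (of `f`, `g`) always `w f · L ≤ log μ − log λ`, then,
chaining the representatives in increasing order and closing up with `E·ℓ_min`, `L·Σ w f ≤ log E`.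
[cite: GoldfeldSchinzel1975, §3 (13), (16)–(18) pp. 578–581] -/
theorem chain_bound {ι : Type*} [DecidableEq ι] (S : Finset ι) (w ℓ : ι → ℝ)
    (Good : ι → ℝ → Prop) {E L : ℝ} (hE : 1 < E)
    (hgood : ∀ f ∈ S, Good f (ℓ f)) (hℓ1 : ∀ f ∈ S, 1 ≤ ℓ f) (hℓE : ∀ f ∈ S, ℓ f < E)
    (hinj : ∀ f ∈ S, ∀ g ∈ S, ℓ f = ℓ g → f = g)
    (hmul : ∀ g ∈ S, ∀ μ, Good g μ → Good g (E * μ))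
    (hpair : ∀ f ∈ S, ∀ g ∈ S, ∀ lam μ : ℝ, Good f lam → Good g μ → lam < μ →
      w f * L ≤ Real.log μ - Real.log lam) :
    (∑ f ∈ S, w f) * L ≤ Real.log E := by
  -- the open chain: all items but the top one
  have key : ∀ T : Finset ι, T ⊆ S → T.Nonempty → ∃ tmin ∈ T, ∃ tmax ∈ T,
      (∀ x ∈ T, ℓ tmin ≤ ℓ x) ∧ (∀ x ∈ T, ℓ x ≤ ℓ tmax) ∧
      (∑ f ∈ T.erase tmax, w f) * L ≤ Real.log (ℓ tmax) - Real.log (ℓ tmin) := by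
    intro T
    induction T using Finset.induction_on_max_value ℓ with
    | empty => intro _ h; exact absurd h Finset.not_nonempty_empty
    | insert a T haT hmax ih =>
      intro hsub _
      have haS : a ∈ S := hsub (Finset.mem_insert_self a T)
      rcases T.eq_empty_or_nonempty with hT | hT
      · subst hT
        refine ⟨a, Finset.mem_insert_self a ∅, a, Finset.mem_insert_self a ∅, ?_, ?_, ?_⟩
        · intro x hx
          rw [Finset.insert_empty, Finset.mem_singleton] at hx
          rw [hx]
        · intro x hx
          rw [Finset.insert_empty, Finset.mem_singleton] at hx
          rw [hx]
        · rw [Finset.erase_insert haT, Finset.sum_empty, zero_mul, sub_self]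
      · obtain ⟨tmin, htmin, tmax, htmax, hlo, hhi, hsum⟩ :=
          ih ((Finset.subset_insert a T).trans hsub) hT
        have htmaxS : tmax ∈ S := hsub (Finset.mem_insert_of_mem htmax)
        refine ⟨tmin, Finset.mem_insert_of_mem htmin, a, Finset.mem_insert_self a T, ?_, ?_, ?_⟩
        · intro x hx
          rcases Finset.mem_insert.mp hx with rfl | hx
          · exact (hlo tmax htmax).trans (hmax tmax htmax)
          · exact hlo x hx
        · intro x hx
          rcases Finset.mem_insert.mp hx with rfl | hx
          · exact le_rfl
          · exact hmax x hx
        · have hne : ℓ tmax ≠ ℓ a := fun h => haT (hinj tmax htmaxS a haS h ▸ htmax)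
          have hlt : ℓ tmax < ℓ a := lt_of_le_of_ne (hmax tmax htmax) hne
          have hstep := hpair tmax htmaxS a haS (ℓ tmax) (ℓ a) (hgood tmax htmaxS)
            (hgood a haS) hlt
          rw [Finset.erase_insert haT, ← Finset.add_sum_erase T w htmax, add_mul]
          linarith
  rcases S.eq_empty_or_nonempty with hS | hS
  · rw [hS, Finset.sum_empty, zero_mul]
    exact (Real.log_pos hE).le
  · obtain ⟨tmin, htmin, tmax, htmax, hlo, hhi, hsum⟩ := key S le_rfl hS
    have h1 := hℓ1 tmin htmin
    have hlt : ℓ tmax < E * ℓ tmin := by nlinarith [hℓE tmax htmax]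
    have hwrap := hpair tmax htmax tmin htmin (ℓ tmax) (E * ℓ tmin) (hgood tmax htmax)
      (hmul tmin htmin _ (hgood tmin htmin)) hlt
    rw [Real.log_mul (by linarith) (by linarith)] at hwrap
    rw [← Finset.add_sum_erase S w htmax, add_mul]
    linarith


/-! #### The norm-form factorisation and the unit automorph (Theorem 2, `d > 0`) -/

/-- `f₀(p, r) = α (p − ω r)(p − ω' r)` for the roots `ω, ω'` of `α x² + β x + γ`
(`α(ω + ω') = −β`, `α ω ω' = γ`). [cite: GoldfeldSchinzel1975, §3 (12) p. 577] -/
theorem eval_eq_mul_factors (f₀ : BinQF) {ω ω' : ℝ} (hsum : (f₀.a : ℝ) * (ω + ω') = -f₀.b)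
    (hprod : (f₀.a : ℝ) * (ω * ω') = f₀.c) (p r : ℤ) :
    ((f₀.eval p r : ℤ) : ℝ) = f₀.a * ((p : ℝ) - ω * r) * ((p : ℝ) - ω' * r) := by
  simp only [BinQF.eval]
  push_cast
  linear_combination ((p : ℝ) * r) * hsum - ((r : ℝ) ^ 2) * hprod

/-- The cross identity `λ μ' − λ' μ = (ω − ω')(p₁ r₂ − p₂ r₁)` for `λ = p₁ − ω r₁`, `μ = p₂ − ω r₂`
and their conjugates. [cite: GoldfeldSchinzel1975, §3 pp. 577–579] -/
theorem cross_identity (ω ω' p₁ r₁ p₂ r₂ : ℝ) :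
    (p₁ - ω * r₁) * (p₂ - ω' * r₂) - (p₁ - ω' * r₁) * (p₂ - ω * r₂) =
      (ω - ω') * (p₁ * r₂ - p₂ * r₁) := by
  ring

/-- The automorph `U = (A₊, γu; −αu, A₋)` (`A₊A₋ + αγu² = 1`, `A₊ − A₋ = βu`) fixes `f₀ = (α, β, γ)`.
[cite: GoldfeldSchinzel1975, §3 p. 580 (the unit ε₀)] -/
theorem act_unit_eq (f₀ : BinQF) {Ap Am u : ℤ} (h1 : Ap * Am + f₀.a * f₀.c * u ^ 2 = 1)
    (h2 : Ap - Am = f₀.b * u) : f₀.act Ap (f₀.c * u) (-(f₀.a * u)) Am = f₀ := by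
  ext <;> simp only [BinQF.act]
  · linear_combination f₀.a * h1 + (f₀.a * Ap) * h2
  · linear_combination f₀.b * h1 + (2 * f₀.a * f₀.c * u) * h2
  · linear_combination f₀.c * h1 - (f₀.c * Am) * h2

/-- The automorph multiplies `λ = p − ω r` by `ε₀ = A₊ + αuω`: for `αω² + βω + γ = 0`,
`(A₊p + γu r) − ω(−αu p + A₋ r) = (A₊ + αuω)(p − ωr)`. [cite: GoldfeldSchinzel1975, §3 p. 580] -/
theorem unit_mul_factor {α β γ ω Ap Am u : ℝ} (hω : α * ω ^ 2 + β * ω + γ = 0)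
    (h2 : Ap - Am = β * u) (p r : ℝ) :
    (Ap * p + γ * u * r) - ω * (-(α * u) * p + Am * r) = (Ap + α * u * ω) * (p - ω * r) := by
  linear_combination (r * u) * hω + (r * ω) * h2

/-- The inverse automorph multiplies `λ` by `ε₀⁻¹ = A₋ − αuω`:
`(A₋p − γu r) − ω(αu p + A₊ r) = (A₋ − αuω)(p − ωr)`. [cite: GoldfeldSchinzel1975, §3 p. 580] -/
theorem unit_inv_mul_factor {α β γ ω Ap Am u : ℝ} (hω : α * ω ^ 2 + β * ω + γ = 0)
    (h2 : Ap - Am = β * u) (p r : ℝ) :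
    (Am * p + -(γ * u) * r) - ω * (α * u * p + Ap * r) = (Am - α * u * ω) * (p - ω * r) := by
  linear_combination (-(r * u)) * hω - (r * ω) * h2

/-- `ε₀ · ε₀⁻¹ = 1` for `ε₀ = A₊ + αuω`, `ε₀⁻¹ = A₋ − αuω`. [cite: GoldfeldSchinzel1975, §3 p. 580] -/
theorem unit_mul_inv {α β γ ω Ap Am u : ℝ} (hω : α * ω ^ 2 + β * ω + γ = 0)
    (h1 : Ap * Am + α * γ * u ^ 2 = 1) (h2 : Ap - Am = β * u) :
    (Ap + α * u * ω) * (Am - α * u * ω) = 1 := by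
  linear_combination (-(α * u ^ 2)) * hω - (α * u * ω) * h2 + h1


/-- The separation step: from `a_f = αλλ'`, `a_g = αμμ'` and `λμ' − λ'μ = (√d/α)k` with `|k| ≥ 1`
(`λ, μ > 0`), `√d ≤ |a_g|/(μ/λ) + |a_f|(μ/λ)`. [cite: GoldfeldSchinzel1975, §3 pp. 578–580] -/
theorem separation {α sD lam lam' μ μ' fa ga k : ℝ} (hα : α ≠ 0) (hsD : 0 < sD) (hlam : 0 < lam)
    (hμ : 0 < μ) (hfa : fa = α * lam * lam') (hga : ga = α * μ * μ')
    (hcross : lam * μ' - lam' * μ = sD / α * k) (hk : 1 ≤ |k|) :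
    sD ≤ |ga| / (μ / lam) + |fa| * (μ / lam) := by
  have hμne : μ ≠ 0 := hμ.ne'
  have hlamne : lam ≠ 0 := hlam.ne'
  have e1 : sD * k = ga * (lam / μ) - fa * (μ / lam) := by
    have h' : α * (lam * μ' - lam' * μ) = sD * k := by rw [hcross]; field_simp
    have ea : α * μ * μ' * (lam / μ) = α * lam * μ' := by field_simp
    have eb : α * lam * lam' * (μ / lam) = α * μ * lam' := by field_simp
    rw [hga, hfa, ea, eb]
    linear_combination -h'
  have e2 : |sD * k| ≤ |ga| * (lam / μ) + |fa| * (μ / lam) := by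
    rw [e1]
    calc |ga * (lam / μ) - fa * (μ / lam)| ≤ |ga * (lam / μ)| + |fa * (μ / lam)| := abs_sub _ _
      _ = |ga| * (lam / μ) + |fa| * (μ / lam) := by
          rw [abs_mul, abs_mul, abs_of_pos (div_pos hlam hμ), abs_of_pos (div_pos hμ hlam)]
  have e3 : sD ≤ |sD * k| := by
    rw [abs_mul, abs_of_pos hsD]; nlinarith
  have e4 : |ga| / (μ / lam) = |ga| * (lam / μ) := by
    rw [div_div_eq_mul_div, mul_div_assoc]
  rw [e4]; linarith

end GoldfeldSchinzel1975

open GoldfeldSchinzel1975 in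
/-- **Goldfeld–Schinzel 1975, Theorem 2, case `d > 676` — PROVED (discharge of the named fact
`goldfeldSchinzel1975_theorem2_pos`, exactly as typed).** The printed proof (§3 pp. 577–582: a
Gauss-reduced `(α, β, γ)`, Jones's Thm 79, Legendre's criterion and Perron's §20 to place every window
form on the continued-fraction cycle `a = (−1)^v Q_v/2`, Lang's Ch. IV Thm 7 for `ε₀ > ∏ b_v`, then the
three-case maximisation of `Σ(x_i + 1)`) is replaced by a shorter norm-form road giving the printed
bound (indeed `Σ 1/|a| ≤ log ε₀/log(½√d − 1)`, without the `4/√d`): write `f = f₀·γ`, `γ = (p q; r s)`,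
so that `a_f = f₀(p, r) = α λ λ'` with `λ = p − ω r`, `λ' = p − ω' r`, `ω, ω' = (−β ± √d)/(2α)`
(`eval_eq_mul_factors`); the automorph `U = ((t₀+βu₀)/2, γu₀; −αu₀, (t₀−βu₀)/2)` of `f₀` multiplies `λ`
by `ε₀ = (t₀ + u₀√d)/2` (`act_unit_eq`, `unit_mul_factor`), so every window form `f ~ f₀` has a
representative `λ_f ∈ [1, ε₀)`, and distinct window forms have distinct `λ_f` (equal `λ` forces
proportional, hence equal, first columns, hence translates `b' = b + 2at`, and `−|a| < b ≤ |a|` gives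
`t = 0`; non-proportional columns would make `√d` rational). For representatives `λ < μ` of window
forms `f, g` the cross identity `λμ' − λ'μ = (√d/α)(p₁r₂ − p₂r₁)` (`cross_identity`) with a NON-ZERO
integer gives `√d ≤ |a_g|/x + |a_f|·x`, `x = μ/λ`, whence `1/|a_f| ≤ log x/log(½√d − 1)`
(`inv_le_log_div_log`; uses `1 ≤ |a| ≤ ¼√d`); chaining the representatives in increasing order and
closing the chain with `ε₀λ_min`, the ratios multiply to `ε₀` (`chain_bound`). The minimality of
`(t₀, u₀)`, the primitivity of `f₀` and the character `χ` are not used; `D` is not a square because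
`t₀² − Du₀² = 4` has a solution with `u₀ ≥ 1` (`D > 676`).
[cite: GoldfeldSchinzel1975, Theorem 2 pp. 571–572 (case d > 676), proof §3 pp. 577–582] -/
theorem goldfeldSchinzel1975_theorem2_pos_holds : goldfeldSchinzel1975_theorem2_pos := by
  intro D _ h676 _ f₀ _ hdisc t₀ u₀ ht₀ hu₀ hpell _ S hS
  -- `√D`
  have hD676 : (676 : ℝ) < D := by exact_mod_cast h676
  set sD := Real.sqrt D with hsD_def
  have hsD2 : sD ^ 2 = D := Real.sq_sqrt (by positivity)
  have hs26 : 26 < sD := by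
    rw [hsD_def, Real.lt_sqrt (by norm_num)]
    linarith
  have hsD0 : 0 < sD := by linarith
  -- `D` is not a square: `t₀² = (n u₀)² + 4` is impossible for `n u₀ ≥ 27`
  have hnsq : ¬ IsSquare D := by
    rintro ⟨n, hn⟩
    have hn27 : 27 ≤ n := by nlinarith
    have hu1 : (1 : ℤ) ≤ u₀ := by exact_mod_cast hu₀
    have ht1 : (0 : ℤ) < t₀ := by exact_mod_cast ht₀
    have hnZ : (27 : ℤ) ≤ n := by exact_mod_cast hn27
    have hsq : (t₀ : ℤ) ^ 2 = ((n : ℤ) * u₀) ^ 2 + 4 := by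
      have : (D : ℤ) = n * n := by exact_mod_cast hn
      rw [this] at hpell
      linear_combination hpell
    have hm : (27 : ℤ) ≤ (n : ℤ) * u₀ := by nlinarith
    have h1 : (n : ℤ) * u₀ < t₀ := by nlinarith
    have h2 : (n : ℤ) * u₀ + 1 ≤ t₀ := h1
    nlinarith
  have hirr : Irrational sD := irrational_sqrt_natCast_iff.mpr hnsq
  -- a form of discriminant `D` has `a ≠ 0`
  have hsqD : ∀ g : BinQF, g.disc = (D : ℤ) → g.a = 0 → IsSquare D := by
    intro g hg h0
    refine ⟨g.b.natAbs, ?_⟩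
    have h : (D : ℤ) = g.b ^ 2 := by rw [← hg]; simp [BinQF.disc, h0]
    have := congrArg Int.natAbs h
    simpa [Int.natAbs_pow, Int.natAbs_mul, sq] using this
  have hane : ∀ f : BinQF, f₀.ProperEquiv f → f.a ≠ 0 := by
    rintro f ⟨p, q, r, s, hdet, rfl⟩ h0
    exact hnsq (hsqD _ (by rw [BinQF.disc_act, hdet, one_pow, one_mul, hdisc]) h0)
  have hα : f₀.a ≠ 0 := hane f₀ (BinQF.ProperEquiv.refl f₀)
  have hαR : (f₀.a : ℝ) ≠ 0 := by exact_mod_cast hα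
  -- the roots `ω, ω'`
  set ω : ℝ := (-(f₀.b : ℝ) + sD) / (2 * f₀.a) with hω_def
  set ω' : ℝ := (-(f₀.b : ℝ) - sD) / (2 * f₀.a) with hω'_def
  have hdiscR : (f₀.b : ℝ) ^ 2 - 4 * f₀.a * f₀.c = sD ^ 2 := by
    rw [hsD2]; exact_mod_cast hdisc
  have hsum : (f₀.a : ℝ) * (ω + ω') = -f₀.b := by
    rw [hω_def, hω'_def]; field_simp; ring
  have hprod : (f₀.a : ℝ) * (ω * ω') = f₀.c := by
    rw [hω_def, hω'_def]; field_simp; linear_combination hdiscR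
  have hdiff : ω - ω' = sD / f₀.a := by
    rw [hω_def, hω'_def]; field_simp; ring
  have hsDω : sD = 2 * f₀.a * ω + f₀.b := by
    rw [hω_def]; field_simp; ring
  have hωeq : (f₀.a : ℝ) * ω ^ 2 + f₀.b * ω + f₀.c = 0 := by
    linear_combination ω * hsum - hprod
  -- the unit `ε₀ = (t₀ + u₀√D)/2` and its automorph
  have hdiscZ : f₀.b ^ 2 - 4 * f₀.a * f₀.c = D := hdisc
  obtain ⟨Ap, hAp⟩ : (2 : ℤ) ∣ (t₀ : ℤ) + f₀.b * u₀ := by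
    rcases Int.even_or_odd ((t₀ : ℤ) + f₀.b * u₀) with h | h
    · exact even_iff_two_dvd.mp h
    · exfalso
      have h' : Odd ((t₀ : ℤ) - f₀.b * u₀) := by
        have e : (t₀ : ℤ) - f₀.b * u₀ = ((t₀ : ℤ) + f₀.b * u₀) - 2 * (f₀.b * u₀) := by ring
        rw [e]; exact h.sub_even (even_two_mul _)
      have hodd := h.mul h'
      have heven : Even (((t₀ : ℤ) + f₀.b * u₀) * ((t₀ : ℤ) - f₀.b * u₀)) :=
        ⟨2 * (1 - f₀.a * f₀.c * (u₀ : ℤ) ^ 2), by linear_combination hpell - (u₀ : ℤ) ^ 2 * hdiscZ⟩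
      exact (Int.not_even_iff_odd.mpr hodd) heven
  set Am : ℤ := t₀ - Ap with hAm
  have h2 : Ap - Am = f₀.b * u₀ := by rw [hAm]; linarith
  have h1 : Ap * Am + f₀.a * f₀.c * (u₀ : ℤ) ^ 2 = 1 := by
    have h4 : (4 : ℤ) * (Ap * Am + f₀.a * f₀.c * (u₀ : ℤ) ^ 2) = 4 * 1 := by
      rw [hAm]
      linear_combination (2 * Ap - (t₀ : ℤ) + f₀.b * u₀) * hAp + hpell - (u₀ : ℤ) ^ 2 * hdiscZ
    exact mul_left_cancel₀ (by norm_num : (4 : ℤ) ≠ 0) h4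
  have hU : f₀.act Ap (f₀.c * u₀) (-(f₀.a * u₀)) Am = f₀ := act_unit_eq f₀ h1 h2
  have hU' : f₀.act Am (-(f₀.c * u₀)) (f₀.a * u₀) Ap = f₀ := by
    have := f₀.act_act_inv (p := Ap) (q := f₀.c * u₀) (r := -(f₀.a * u₀)) (s := Am)
      (by linear_combination h1)
    rwa [hU, neg_neg] at this
  have h1R : (Ap : ℝ) * Am + f₀.a * f₀.c * (u₀ : ℝ) ^ 2 = 1 := by exact_mod_cast h1
  have h2R : (Ap : ℝ) - Am = f₀.b * u₀ := by exact_mod_cast h2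
  have hApR : (t₀ : ℝ) + f₀.b * u₀ = 2 * Ap := by exact_mod_cast hAp
  set ε : ℝ := ((t₀ : ℝ) + (u₀ : ℝ) * sD) / 2 with hε_def
  have hεω : ε = Ap + f₀.a * u₀ * ω := by
    rw [hε_def, hsDω]; linear_combination hApR / 2
  have hε1 : 1 < ε := by
    have : (1 : ℝ) ≤ t₀ := by exact_mod_cast ht₀
    have : (1 : ℝ) ≤ u₀ := by exact_mod_cast hu₀
    rw [hε_def]; nlinarith
  have hε0 : 0 < ε := by linarith
  have hεinv : ε⁻¹ = Am - f₀.a * u₀ * ω := by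
    apply inv_eq_of_mul_eq_one_right
    rw [hεω]; exact unit_mul_inv hωeq h1R h2R
  -- admissible representatives `λ = p − ω r > 0` of a form `f = f₀·γ`
  set Good : BinQF → ℝ → Prop := fun f lam =>
    ∃ p q r s : ℤ, p * s - q * r = 1 ∧ f = f₀.act p q r s ∧ lam = (p : ℝ) - ω * r ∧ 0 < lam
    with hGood
  have hmulE : ∀ f lam, Good f lam → Good f (ε * lam) := by
    rintro f lam ⟨p, q, r, s, hdet, hf, hlam, hpos⟩
    refine ⟨Ap * p + f₀.c * u₀ * r, Ap * q + f₀.c * u₀ * s, -(f₀.a * u₀) * p + Am * r,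
      -(f₀.a * u₀) * q + Am * s, ?_, ?_, ?_, mul_pos hε0 hpos⟩
    · linear_combination (p * s - q * r) * h1 + hdet
    · calc f = f₀.act p q r s := hf
        _ = (f₀.act Ap (f₀.c * u₀) (-(f₀.a * u₀)) Am).act p q r s := by rw [hU]
        _ = _ := by rw [BinQF.act_act]
    · rw [hlam, hεω]; push_cast
      exact (unit_mul_factor hωeq h2R (p : ℝ) (r : ℝ)).symm
  have hmulE' : ∀ f lam, Good f lam → Good f (ε⁻¹ * lam) := by
    rintro f lam ⟨p, q, r, s, hdet, hf, hlam, hpos⟩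
    refine ⟨Am * p + -(f₀.c * u₀) * r, Am * q + -(f₀.c * u₀) * s, f₀.a * u₀ * p + Ap * r,
      f₀.a * u₀ * q + Ap * s, ?_, ?_, ?_, mul_pos (inv_pos.mpr hε0) hpos⟩
    · linear_combination (p * s - q * r) * h1 + hdet
    · calc f = f₀.act p q r s := hf
        _ = (f₀.act Am (-(f₀.c * u₀)) (f₀.a * u₀) Ap).act p q r s := by rw [hU']
        _ = _ := by rw [BinQF.act_act]
    · rw [hlam, hεinv]; push_cast
      exact (unit_inv_mul_factor hωeq h2R (p : ℝ) (r : ℝ)).symm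
  have hzpow : ∀ (n : ℤ) (f : BinQF) (lam : ℝ), Good f lam → Good f (ε ^ n * lam) := by
    intro n
    induction n using Int.induction_on with
    | zero => intro f lam h; simpa using h
    | succ n ih =>
      intro f lam h
      rw [zpow_add_one₀ hε0.ne', mul_comm (ε ^ (n : ℤ)) ε, mul_assoc]
      exact hmulE _ _ (ih f lam h)
    | pred n ih =>
      intro f lam h
      rw [zpow_sub_one₀ hε0.ne', mul_comm (ε ^ (-(n : ℤ))) ε⁻¹, mul_assoc]
      exact hmulE' _ _ (ih f lam h)
  -- every window form has a representative in `[1, ε₀)`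
  have hexists : ∀ f ∈ S, ∃ lam, Good f lam ∧ 1 ≤ lam ∧ lam < ε := by
    intro f hf
    obtain ⟨⟨p, q, r, s, hdet, hfeq⟩, -, -, -⟩ := hS f hf
    have hfa : f.a ≠ 0 := hane f ⟨p, q, r, s, hdet, hfeq⟩
    have hfaR : (f.a : ℝ) = f₀.a * ((p : ℝ) - ω * r) * ((p : ℝ) - ω' * r) := by
      rw [hfeq, BinQF.a_act]; exact eval_eq_mul_factors f₀ hsum hprod p r
    have hl0 : ((p : ℝ) - ω * r) ≠ 0 := by
      intro h0
      apply hfa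
      have : (f.a : ℝ) = 0 := by rw [hfaR, h0]; ring
      exact_mod_cast this
    obtain ⟨lam1, hg1⟩ : ∃ lam1, Good f lam1 := by
      rcases lt_or_gt_of_ne hl0 with hneg | hpos
      · refine ⟨-((p : ℝ) - ω * r), -p, -q, -r, -s, by linear_combination hdet, ?_,
          by push_cast; ring, by linarith⟩
        rw [hfeq]; ext <;> simp only [BinQF.act] <;> ring
      · exact ⟨_, p, q, r, s, hdet, hfeq, rfl, hpos⟩
    have hpos1 : 0 < lam1 := by obtain ⟨_, _, _, _, _, _, _, h⟩ := hg1; exact h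
    obtain ⟨n, hn1, hn2⟩ := exists_mem_Ico_zpow hpos1 hε1
    refine ⟨ε ^ (-n) * lam1, hzpow (-n) f lam1 hg1, ?_, ?_⟩
    · have e : ε ^ (-n) * ε ^ n = 1 := by
        rw [zpow_neg]; exact inv_mul_cancel₀ (zpow_ne_zero n hε0.ne')
      calc (1 : ℝ) = ε ^ (-n) * ε ^ n := e.symm
        _ ≤ ε ^ (-n) * lam1 := mul_le_mul_of_nonneg_left hn1 (zpow_nonneg hε0.le _)
    · calc ε ^ (-n) * lam1 < ε ^ (-n) * ε ^ (n + 1) := mul_lt_mul_of_pos_left hn2 (zpow_pos hε0 _)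
        _ = ε := by rw [← zpow_add₀ hε0.ne', show -n + (n + 1) = 1 by ring, zpow_one]
  choose! ℓ hℓgood hℓ1 hℓE using hexists
  -- window forms: `1 ≤ |a| ≤ ¼√D`
  have hL : 0 < Real.log (sD / 2 - 1) := Real.log_pos (by linarith)
  have hwin : ∀ f ∈ S, (1 : ℝ) ≤ |(f.a : ℝ)| ∧ 4 * |(f.a : ℝ)| ≤ sD := by
    intro f hf
    obtain ⟨hpe, -, -, h16⟩ := hS f hf
    have hfa : f.a ≠ 0 := hane f hpe
    refine ⟨?_, ?_⟩
    · have h : (1 : ℤ) ≤ |f.a| := Int.one_le_abs hfa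
      have : ((1 : ℤ) : ℝ) ≤ ((|f.a| : ℤ) : ℝ) := by exact_mod_cast h
      simpa [Int.cast_abs] using this
    · have h16R : (16 : ℝ) * (f.a : ℝ) ^ 2 ≤ D := by exact_mod_cast h16
      nlinarith [abs_nonneg (f.a : ℝ), sq_abs (f.a : ℝ)]
  -- the pair inequality
  have hpair : ∀ f ∈ S, ∀ g ∈ S, ∀ lam μ : ℝ, Good f lam → Good g μ → lam < μ →
      1 / |(f.a : ℝ)| * Real.log (sD / 2 - 1) ≤ Real.log μ - Real.log lam := by
    rintro f hf g hg lam μ ⟨p₁, q₁, r₁, s₁, hdet₁, hf₁, hlam, hlam0⟩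
      ⟨p₂, q₂, r₂, s₂, hdet₂, hg₂, hμ, hμ0⟩ hlt
    obtain ⟨hA1, hA4⟩ := hwin f hf
    obtain ⟨hB1, hB4⟩ := hwin g hg
    set lam' : ℝ := (p₁ : ℝ) - ω' * r₁ with hlam'_def
    set μ' : ℝ := (p₂ : ℝ) - ω' * r₂ with hμ'_def
    have hfa : (f.a : ℝ) = f₀.a * lam * lam' := by
      rw [hf₁, BinQF.a_act, hlam]; exact eval_eq_mul_factors f₀ hsum hprod p₁ r₁
    have hga : (g.a : ℝ) = f₀.a * μ * μ' := by
      rw [hg₂, BinQF.a_act, hμ]; exact eval_eq_mul_factors f₀ hsum hprod p₂ r₂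
    have hcross : lam * μ' - lam' * μ = sD / f₀.a * (((p₁ * r₂ - p₂ * r₁ : ℤ) : ℝ)) := by
      rw [hlam, hμ, hlam'_def, hμ'_def, ← hdiff]; push_cast
      exact cross_identity ω ω' p₁ r₁ p₂ r₂
    by_cases hk0 : p₁ * r₂ - p₂ * r₁ = 0
    · exfalso
      -- the first columns are proportional: `(p₁, r₁) = m (p₂, r₂)`, `m = p₁ s₂ − q₂ r₁`
      have e1 : p₁ = (p₁ * s₂ - q₂ * r₁) * p₂ := by
        linear_combination (-p₁) * hdet₂ - q₂ * hk0
      have e2 : r₁ = (p₁ * s₂ - q₂ * r₁) * r₂ := by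
        linear_combination (-r₁) * hdet₂ - s₂ * hk0
      have e1R : (p₁ : ℝ) = ((p₁ * s₂ - q₂ * r₁ : ℤ) : ℝ) * p₂ := by exact_mod_cast e1
      have e2R : (r₁ : ℝ) = ((p₁ * s₂ - q₂ * r₁ : ℤ) : ℝ) * r₂ := by exact_mod_cast e2
      have e3 : lam = ((p₁ * s₂ - q₂ * r₁ : ℤ) : ℝ) * μ := by
        rw [hlam, hμ]; linear_combination e1R - ω * e2R
      have hm0 : (0 : ℝ) < ((p₁ * s₂ - q₂ * r₁ : ℤ) : ℝ) := by
        rw [e3] at hlam0; exact pos_of_mul_pos_left hlam0 hμ0.le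
      have hm1 : ((p₁ * s₂ - q₂ * r₁ : ℤ) : ℝ) < 1 := by
        rw [e3] at hlt; exact (mul_lt_iff_lt_one_left hμ0).mp hlt
      have h0' : (0 : ℤ) < p₁ * s₂ - q₂ * r₁ := by exact_mod_cast hm0
      have h1' : p₁ * s₂ - q₂ * r₁ < 1 := by exact_mod_cast hm1
      omega
    · have hk1 : (1 : ℝ) ≤ |(((p₁ * r₂ - p₂ * r₁ : ℤ)) : ℝ)| := by
        rw [← Int.cast_abs]; exact_mod_cast Int.one_le_abs hk0
      have hx : 1 < μ / lam := (one_lt_div hlam0).mpr hlt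
      have hkey : sD ≤ |(g.a : ℝ)| / (μ / lam) + |(f.a : ℝ)| * (μ / lam) :=
        separation hαR hsD0 hlam0 hμ0 hfa hga hcross hk1
      have hmain := inv_le_log_div_log hs26 hA1 hA4 (by linarith) hB4 hx hkey
      rw [Real.log_div hμ0.ne' hlam0.ne'] at hmain
      rwa [le_div_iff₀ hL] at hmain
  -- distinct window forms have distinct representatives
  have hinj : ∀ f ∈ S, ∀ g ∈ S, ℓ f = ℓ g → f = g := by
    intro f hf g hg heq
    obtain ⟨p₁, q₁, r₁, s₁, hdet₁, hf₁, hlam, hlam0⟩ := hℓgood f hf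
    obtain ⟨p₂, q₂, r₂, s₂, hdet₂, hg₂, hμ, hμ0⟩ := hℓgood g hg
    rw [heq] at hlam
    obtain ⟨-, hbf1, hbf2, -⟩ := hS f hf
    obtain ⟨-, hbg1, hbg2, -⟩ := hS g hg
    by_cases hk0 : p₁ * r₂ - p₂ * r₁ = 0
    · -- proportional columns with the same `λ`: equal columns, translates, equal forms
      have e1 : p₁ = (p₁ * s₂ - q₂ * r₁) * p₂ := by
        linear_combination (-p₁) * hdet₂ - q₂ * hk0
      have e2 : r₁ = (p₁ * s₂ - q₂ * r₁) * r₂ := by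
        linear_combination (-r₁) * hdet₂ - s₂ * hk0
      have e1R : (p₁ : ℝ) = ((p₁ * s₂ - q₂ * r₁ : ℤ) : ℝ) * p₂ := by exact_mod_cast e1
      have e2R : (r₁ : ℝ) = ((p₁ * s₂ - q₂ * r₁ : ℤ) : ℝ) * r₂ := by exact_mod_cast e2
      have e3 : ℓ g = ((p₁ * s₂ - q₂ * r₁ : ℤ) : ℝ) * ℓ g := by
        conv_lhs => rw [hlam]
        conv_rhs => rw [hμ]
        linear_combination e1R - ω * e2R
      have hm1R : ((p₁ * s₂ - q₂ * r₁ : ℤ) : ℝ) = 1 := by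
        have : (((p₁ * s₂ - q₂ * r₁ : ℤ) : ℝ) - 1) * ℓ g = 0 := by linear_combination -e3
        rcases mul_eq_zero.mp this with h | h
        · linarith
        · exact absurd h hμ0.ne'
      have hm1 : p₁ * s₂ - q₂ * r₁ = 1 := by exact_mod_cast hm1R
      have hp : p₁ = p₂ := by rw [hm1, one_mul] at e1; exact e1
      have hr : r₁ = r₂ := by rw [hm1, one_mul] at e2; exact e2
      -- `g = f·(1 t; 0 1)` with `t = s₁ q₂ − q₁ s₂`
      have ht1 : p₁ * (s₁ * q₂ - q₁ * s₂) + q₁ = q₂ := by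
        linear_combination q₂ * hdet₁ - q₁ * hm1
      have ht2 : r₁ * (s₁ * q₂ - q₁ * s₂) + s₁ = s₂ := by
        linear_combination s₂ * hdet₁ - s₁ * hm1
      have hgf : g = f.act 1 (s₁ * q₂ - q₁ * s₂) 0 1 := by
        rw [hg₂, hf₁, BinQF.act_act, ← hp, ← hr]
        simp only [mul_one, mul_zero, add_zero]
        rw [ht1, ht2]
      have hga : g.a = f.a := by rw [hgf]; simp [BinQF.act]
      have hgb : g.b = 2 * f.a * (s₁ * q₂ - q₁ * s₂) + f.b := by rw [hgf]; simp [BinQF.act]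
      rw [hga] at hbg1 hbg2
      rw [hgb] at hbg1 hbg2
      have ht0 : s₁ * q₂ - q₁ * s₂ = 0 := by
        by_contra hne
        have h1 : (1 : ℤ) ≤ |s₁ * q₂ - q₁ * s₂| := Int.one_le_abs hne
        have h2 : |2 * f.a * (s₁ * q₂ - q₁ * s₂)| < 2 * |f.a| := by
          rw [abs_lt]; constructor <;> linarith
        rw [abs_mul, abs_mul, abs_two] at h2
        have h3 : 2 * |f.a| * 1 ≤ 2 * |f.a| * |s₁ * q₂ - q₁ * s₂| :=
          mul_le_mul_of_nonneg_left h1 (by positivity)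
        linarith
      rw [ht0] at hgf
      rw [hgf, BinQF.act_one]
    · exfalso
      set lam' : ℝ := (p₁ : ℝ) - ω' * r₁ with hlam'_def
      set μ' : ℝ := (p₂ : ℝ) - ω' * r₂ with hμ'_def
      have hfa : (f.a : ℝ) = f₀.a * ℓ g * lam' := by
        have h := eval_eq_mul_factors f₀ hsum hprod p₁ r₁
        rw [← f₀.a_act p₁ q₁ r₁ s₁, ← hf₁, ← hlam] at h
        exact h
      have hga : (g.a : ℝ) = f₀.a * ℓ g * μ' := by
        have h := eval_eq_mul_factors f₀ hsum hprod p₂ r₂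
        rw [← f₀.a_act p₂ q₂ r₂ s₂, ← hg₂, ← hμ] at h
        exact h
      have hc := cross_identity ω ω' (p₁ : ℝ) r₁ p₂ r₂
      rw [← hlam, ← hμ, hdiff] at hc
      have e : (f₀.a : ℝ) * (ℓ g * μ' - lam' * ℓ g) = sD * ((p₁ : ℝ) * r₂ - p₂ * r₁) := by
        rw [hμ'_def, hlam'_def, hc]; field_simp
      have hrat : sD * (((p₁ * r₂ - p₂ * r₁ : ℤ)) : ℝ) = (((g.a - f.a : ℤ)) : ℝ) := by
        push_cast
        rw [hga, hfa]
        linear_combination -e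
      exact (hirr.mul_intCast hk0).ne_int _ hrat
  -- assemble
  have hchain := chain_bound S (fun f => 1 / |(f.a : ℝ)|) ℓ Good hε1 hℓgood hℓ1 hℓE hinj
    (fun g _ μ h => hmulE g μ h) hpair
  have hfin : ∑ f ∈ S, (1 : ℝ) / |(f.a : ℝ)| ≤ Real.log ε / Real.log (sD / 2 - 1) := by
    rw [le_div_iff₀ hL]; exact hchain
  have h4 : (0 : ℝ) ≤ 4 / sD := by positivity
  linarith

end Literature.NumberTheory.LFunctions

end
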